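import Summits.NavierStokesRegularity.NavierStokesRegularity.Theorems.StrainDoorsThreshold
import Literature.Analysis.FluidPDE.ClassicalSolutionGlue
import Literature.Analysis.FluidPDE.TaoEnstrophyLocalisation
import Literature.Analysis.FluidPDE.SpaceTimeCalculus
import HarnessLib

/-!
# StrainClockThresholdWeighted — S39 «LocalStrainClock» (nsreg-p1 g32, ROUND-37) engine plate
# E2_S^w «StrainThresholdWeighted»: the EXACT strain threshold device for the PENALISED strain form on a closed slab

S-door lane (ns-sfl-p1 g5; KEY nsreg-p1 g32 2026-08-28T20:14:07Z, text verbatim from that line; LEAD ns-s30-p1 g3;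
`--supports stmt-NavierStokesRegularity-0056 --as helper`). The NS instance of the LEAD's EXACT-maximiser device
`ArgmaxDoors.rayleigh_le_supersolution_of_argmax_growth` (p655218) with the FIXED penalisation weight: on a closed
slab `[s₁,s₂]`, for a classical unforced solution with BOUNDED GRADIENT, the operator field
`W(r,y) = (1 + ε|y|²)⁻¹ ∇u(r + s₁, y)` is jointly smooth and DECAYS uniformly (`‖W‖ ≤ K(1 + ε|y|²)⁻¹`), so the exact
first-touch comparison applies to the penalised Rayleigh quotients `(1 + ε|x|²)⁻¹⟪∇u(s,x)e, e⟫` — no almost-maximisers,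
no `η`, no `δ`. Template: `strainThresholdAncient` (p661976; time shift `[s₁,s₂] ↦ [0, s₂−s₁]`,
`IsSmoothSpaceTimeOn.comp_add_right`, `timeDerivWithin_comp_add_right`), plus `isSmoothSpaceTimeOn_const_time … .smul`
for the weight and `HasDerivWithinAt.const_smul` for its time derivative.

WHAT THIS IS NOT: the engine of CONDITIONAL Liouville-type criteria (door family S39); item 0056 `NoTypeII`, the
Liouville conjecture 10661 and NS regularity are NOT proved; nothing here is a route or a summit statement.
-/

-- the summit's problem namespace repeats the summit name (tree layout)
set_option linter.dupNamespace false

noncomputable section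

open Set Function Filter Topology InnerProductSpace
open scoped RealInnerProductSpace ContDiff
open Literature.Analysis Literature.Analysis.FluidPDE

namespace Summit.NavierStokesRegularity.NavierStokesRegularity.Theorems.ArgmaxDoors

-- nested operator types (second derivatives)
set_option maxSynthPendingDepth 3

/-- The penalisation weight `y ↦ (1 + ε|y|²)⁻¹` is smooth for `ε ≥ 0`. -/
theorem contDiff_penWeight {ε : ℝ} (hε : 0 ≤ ε) :
    ContDiff ℝ ∞ (fun y : EuclideanSpace ℝ (Fin 3) => (1 + ε * ‖y‖ ^ 2)⁻¹) := by
  refine ContDiff.inv (contDiff_const.add (contDiff_const.mul (contDiff_norm_sq ℝ))) fun y => ?_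
  have : 0 < 1 + ε * ‖y‖ ^ 2 := by positivity
  exact this.ne'

/-- **Plate E2_S^w «StrainThresholdWeighted»** (nsreg-p1 g32 ROUND-37, text of 2026-08-28T20:14:07Z), PROVED:
the exact strain threshold comparison for the penalised strain form `(1 + ε|x|²)⁻¹⟪∇u(s,x)e,e⟫` on a closed slab,
for classical unforced solutions with bounded gradient. -/
theorem strainThresholdWeighted : ∀ (ν s₁ s₂ ε : ℝ), 0 < ν → s₁ < s₂ → 0 < ε →
    ∀ (u : ℝ → EuclideanSpace ℝ (Fin 3) → EuclideanSpace ℝ (Fin 3)) (p : ℝ → EuclideanSpace ℝ (Fin 3) → ℝ),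
      IsClassicalNSSolutionOn (Icc s₁ s₂) ν 0 u p →
      (∃ K : ℝ, ∀ s ∈ Icc s₁ s₂, ∀ x : EuclideanSpace ℝ (Fin 3), ‖fderiv ℝ (u s) x‖ ≤ K) →
      ∀ (B B' φ : ℝ → ℝ), ContinuousOn B (Icc s₁ s₂) → (∀ s ∈ Icc s₁ s₂, 0 < B s) →
        (∀ s ∈ Icc s₁ s₂, HasDerivWithinAt B (B' s) (Icc s₁ s₂) s) →
        (∀ s ∈ Icc s₁ s₂, φ s * B s ≤ B' s) →
        (∀ s ∈ Ioc s₁ s₂, ∀ (x e : EuclideanSpace ℝ (Fin 3)), ‖e‖ = 1 →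
          (∀ (y e' : EuclideanSpace ℝ (Fin 3)), ‖e'‖ = 1 →
            (1 + ε * ‖y‖ ^ 2)⁻¹ * ⟪fderiv ℝ (u s) y e', e'⟫ ≤ (1 + ε * ‖x‖ ^ 2)⁻¹ * ⟪fderiv ℝ (u s) x e, e⟫) →
          B s < (1 + ε * ‖x‖ ^ 2)⁻¹ * ⟪fderiv ℝ (u s) x e, e⟫ →
          (1 + ε * ‖x‖ ^ 2)⁻¹ * ⟪timeDerivWithin (Icc s₁ s₂) (fun r y => fderiv ℝ (u r) y e) s x, e⟫ ≤
            φ s * ((1 + ε * ‖x‖ ^ 2)⁻¹ * ⟪fderiv ℝ (u s) x e, e⟫)) →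
        (∀ (x e : EuclideanSpace ℝ (Fin 3)), ‖e‖ = 1 → (1 + ε * ‖x‖ ^ 2)⁻¹ * ⟪fderiv ℝ (u s₁) x e, e⟫ ≤ B s₁) →
        ∀ s ∈ Icc s₁ s₂, ∀ (x e : EuclideanSpace ℝ (Fin 3)), ‖e‖ = 1 →
          (1 + ε * ‖x‖ ^ 2)⁻¹ * ⟪fderiv ℝ (u s) x e, e⟫ ≤ B s := by
  intro ν s₁ s₂ ε hν h12 hε u p hsol hK B B' φ hBc hBpos hBd hsuper hrate hinit s hs x e he
  set L : ℝ := s₂ - s₁ with hLdef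
  have hL : 0 < L := by rw [hLdef]; linarith
  have hUS : UniqueDiffOn ℝ (Icc s₁ s₂) := uniqueDiffOn_Icc h12
  have hUL : UniqueDiffOn ℝ (Icc (0 : ℝ) L) := uniqueDiffOn_Icc hL
  set G : ℝ → (EuclideanSpace ℝ (Fin 3)) → ((EuclideanSpace ℝ (Fin 3)) →L[ℝ] (EuclideanSpace ℝ (Fin 3))) :=
    fun r y => fderiv ℝ (u r) y with hG
  have hGs : IsSmoothSpaceTimeOn (Icc s₁ s₂) G := hsol.smooth_velocity.fderiv_slice hUS
  have hmem : ∀ r ∈ Icc (0 : ℝ) L, r + s₁ ∈ Icc s₁ s₂ := fun r hr =>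
    ⟨by linarith [hr.1], by rw [hLdef] at hr; linarith [hr.2]⟩
  have hpre : (· + s₁) ⁻¹' Icc s₁ s₂ = Icc (0 : ℝ) L := by
    ext r; simp only [mem_preimage, mem_Icc, hLdef]; constructor <;> intro h <;> constructor <;> linarith [h.1, h.2]
  -- the weight and the weighted, shifted operator field
  set wt : (EuclideanSpace ℝ (Fin 3)) → ℝ := fun y => (1 + ε * ‖y‖ ^ 2)⁻¹ with hwt
  have hwtC : ContDiff ℝ ∞ wt := contDiff_penWeight hε.le
  have hwt0 : ∀ y, 0 < wt y := fun y => by rw [hwt]; positivity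
  set V : ℝ → (EuclideanSpace ℝ (Fin 3)) → ((EuclideanSpace ℝ (Fin 3)) →L[ℝ] (EuclideanSpace ℝ (Fin 3))) :=
    fun r y => G (r + s₁) y with hV
  have hVs : IsSmoothSpaceTimeOn (Icc 0 L) V := by
    have h := hGs.comp_add_right s₁
    rw [hpre] at h
    exact h
  set W : ℝ → (EuclideanSpace ℝ (Fin 3)) → ((EuclideanSpace ℝ (Fin 3)) →L[ℝ] (EuclideanSpace ℝ (Fin 3))) :=
    fun r y => wt y • V r y with hW
  have hWs : IsSmoothSpaceTimeOn (Icc 0 L) W := (isSmoothSpaceTimeOn_const_time hwtC _).smul hVs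
  have hWe : ∀ r y e', ⟪W r y e', e'⟫ = (1 + ε * ‖y‖ ^ 2)⁻¹ * ⟪fderiv ℝ (u (r + s₁)) y e', e'⟫ := by
    intro r y e'
    simp only [hW, hV, hG, hwt, smul_apply, real_inner_smul_left]
  -- uniform decay of `W` from the bounded gradient and the weight
  obtain ⟨K, hK'⟩ := hK
  have hunif : ∀ η : ℝ, 0 < η → ∃ R : ℝ, ∀ r ∈ Icc (0 : ℝ) L, ∀ y : EuclideanSpace ℝ (Fin 3),
      R ≤ ‖y‖ → ‖W r y‖ ≤ η := by
    intro η hη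
    refine ⟨max 1 ((|K| + 1) / (ε * η)), fun r hr y hy => ?_⟩
    have hy1 : 1 ≤ ‖y‖ := (le_max_left _ _).trans hy
    have hy2 : (|K| + 1) / (ε * η) ≤ ‖y‖ := (le_max_right _ _).trans hy
    have hGK : ‖G (r + s₁) y‖ ≤ |K| := (hK' _ (hmem r hr) y).trans (le_abs_self K)
    have hden : |K| + 1 ≤ η * (1 + ε * ‖y‖ ^ 2) := by
      rw [div_le_iff₀ (by positivity)] at hy2
      have hyy : ‖y‖ ≤ ‖y‖ ^ 2 := by nlinarith [hy1]
      nlinarith [hy2, hη.le, mul_nonneg (sub_nonneg.2 hyy) (mul_nonneg hε.le hη.le)]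
    have hw1 : ‖W r y‖ = (1 + ε * ‖y‖ ^ 2)⁻¹ * ‖G (r + s₁) y‖ := by
      simp only [hW, hV, hwt, norm_smul, Real.norm_eq_abs, abs_inv, abs_of_pos (show (0:ℝ) < 1 + ε * ‖y‖ ^ 2 by positivity)]
    rw [hw1, inv_mul_le_iff₀ (by positivity : (0:ℝ) < 1 + ε * ‖y‖ ^ 2)]
    nlinarith [hGK, hden, norm_nonneg (G (r + s₁) y)]
  -- the shifted barrier
  have hBc' : ContinuousOn (fun r => B (r + s₁)) (Icc 0 L) :=
    hBc.comp (continuous_add_const s₁).continuousOn hmem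
  have hBpos' : ∀ r ∈ Icc 0 L, 0 < B (r + s₁) := fun r hr => hBpos _ (hmem r hr)
  have hBd' : ∀ r ∈ Icc 0 L, HasDerivWithinAt (fun r' => B (r' + s₁)) (B' (r + s₁)) (Icc 0 L) r := by
    intro r hr
    have h1 : HasDerivWithinAt (fun r' : ℝ => r' + s₁) 1 (Icc 0 L) r := (hasDerivWithinAt_id r _).add_const s₁
    have h := (hBd (r + s₁) (hmem r hr)).comp r h1 (fun r' hr' => hmem r' hr')
    rw [mul_one] at h
    exact h
  have hsuper' : ∀ r ∈ Icc 0 L, φ (r + s₁) * B (r + s₁) ≤ B' (r + s₁) := fun r hr => hsuper _ (hmem r hr)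
  -- the time derivative of the weighted shifted field, applied to `e₀`
  have hkey : ∀ r ∈ Icc 0 L, ∀ (x₀ e₀ : EuclideanSpace ℝ (Fin 3)),
      timeDerivWithin (Icc 0 L) W r x₀ e₀ =
        (1 + ε * ‖x₀‖ ^ 2)⁻¹ • timeDerivWithin (Icc s₁ s₂) (fun r' y => fderiv ℝ (u r') y e₀) (r + s₁) x₀ := by
    intro r hr x₀ e₀
    have hr' : r + s₁ ∈ Icc s₁ s₂ := hmem r hr
    set D := timeDerivWithin (Icc s₁ s₂) G (r + s₁) x₀ with hD
    have hF : HasDerivWithinAt (fun r' => G r' x₀) D (Icc s₁ s₂) (r + s₁) := by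
      rw [hD, timeDerivWithin_apply]
      exact (hGs.differentiableWithinAt_time hr' x₀).hasDerivWithinAt
    have h1 : timeDerivWithin (Icc s₁ s₂) (fun r' y => fderiv ℝ (u r') y e₀) (r + s₁) x₀ = D e₀ := by
      rw [timeDerivWithin_apply]
      have h := hF.clm_apply (hasDerivWithinAt_const (r + s₁) (Icc s₁ s₂) e₀)
      have h' : HasDerivWithinAt (fun r' => G r' x₀ e₀) (D e₀) (Icc s₁ s₂) (r + s₁) := by simpa using h
      exact h'.derivWithin (hUS _ hr')
    have h2 : timeDerivWithin (Icc 0 L) V r x₀ = D := by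
      have e1 := timeDerivWithin_comp_add_right (Icc s₁ s₂) G s₁ r x₀
      rw [hpre] at e1
      exact e1
    -- `V (·) x₀` is differentiable within `Icc 0 L` at `r` with derivative `D`
    have hVd : HasDerivWithinAt (fun r' => V r' x₀) D (Icc 0 L) r := by
      have h := (hVs.differentiableWithinAt_time hr x₀).hasDerivWithinAt
      rw [← timeDerivWithin_apply, h2] at h
      exact h
    have hWd : HasDerivWithinAt (fun r' => W r' x₀) (wt x₀ • D) (Icc 0 L) r := hVd.const_smul (wt x₀)
    rw [timeDerivWithin_apply, hWd.derivWithin (hUL r hr), smul_apply, h1]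
  have hgrow : ∀ r ∈ Icc 0 L, 0 < r → ∀ (x₀ e₀ : EuclideanSpace ℝ (Fin 3)), ‖e₀‖ = 1 →
      (∀ (y e' : EuclideanSpace ℝ (Fin 3)), ‖e'‖ = 1 → ⟪W r y e', e'⟫ ≤ ⟪W r x₀ e₀, e₀⟫) →
      B (r + s₁) < ⟪W r x₀ e₀, e₀⟫ →
      ⟪timeDerivWithin (Icc 0 L) W r x₀ e₀, e₀⟫ ≤ φ (r + s₁) * ⟪W r x₀ e₀, e₀⟫ := by
    intro r hr hrpos x₀ e₀ he₀ hmax hbig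
    rw [hkey r hr x₀ e₀, real_inner_smul_left, hWe]
    have hmax' : ∀ (y e' : EuclideanSpace ℝ (Fin 3)), ‖e'‖ = 1 →
        (1 + ε * ‖y‖ ^ 2)⁻¹ * ⟪fderiv ℝ (u (r + s₁)) y e', e'⟫ ≤
          (1 + ε * ‖x₀‖ ^ 2)⁻¹ * ⟪fderiv ℝ (u (r + s₁)) x₀ e₀, e₀⟫ := by
      intro y e' he'; rw [← hWe, ← hWe]; exact hmax y e' he'
    have hbig' : B (r + s₁) < (1 + ε * ‖x₀‖ ^ 2)⁻¹ * ⟪fderiv ℝ (u (r + s₁)) x₀ e₀, e₀⟫ := by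
      rw [← hWe]; exact hbig
    exact hrate (r + s₁) ⟨by linarith, (hmem r hr).2⟩ x₀ e₀ he₀ hmax' hbig'
  have hM : ∀ (y e' : EuclideanSpace ℝ (Fin 3)), ‖e'‖ = 1 → ⟪W 0 y e', e'⟫ ≤ B (0 + s₁) := by
    intro y e' he'
    rw [hWe, zero_add]
    exact hinit y e' he'
  have hmain := rayleigh_le_supersolution_of_argmax_growth (φ := fun r => φ (r + s₁)) hWs hunif hBc'
    hBpos' hBd' hsuper' hgrow hM (s - s₁) ⟨by linarith [hs.1], by rw [hLdef]; linarith [hs.2]⟩ x e he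
  rw [hWe, sub_add_cancel] at hmain
  exact hmain

end Summit.NavierStokesRegularity.NavierStokesRegularity.Theorems.ArgmaxDoors

end
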